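import Summits.QuantumFields.BalabanUV.T4Continuum.Spine.NE1p.TiltedMeanInfluence
import Mathlib.MeasureTheory.Integral.Layercake

/-!
# BalabanUVNodes ∕ N19 — THE TV CURRENCY, ONE CLASS: two normalised class laws close on every SET ⇒ close on every bounded integral,
# on the dressed (MGF) class terms modulo the mass ratio, and on the tilted means; the indicator MGFs; SHAPE ⇒ TV is STRICT

Cell `pub-ymgap` (HUMAN RULING D-0062, Track A), node N19 = NE7, R134 seat `pub-ymgap-dag-n19-c` (g8).  The generic one-class half of
`…N19CoreTVInvariant` (split under the 400-line rule).  Filed `--kind proof --supports` K3⁗ `SpineGivenEndpointR13Sep` = stmt-QuantumFields-20292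
`--as helper` (dag-lead WORDS-140 key map).  COUNT-NEUTRAL.  THEOREMS ONLY (0 `def`); imports gaps-ne1's `Spine/NE1p/TiltedMeanInfluence` (`DressedMGFForm.tiltedMean`,
`tiltedMean_eq_div`, `abs_tiltedMean_le`) and Mathlib's layer cake; edits nothing.  «TV» below = closeness of two probability laws on every
measurable SET (reference-measure-free; the set-function face of ne1 gen 5's L¹ ledger and of n14-c's law defect).

WHAT IS PROVED ([folklore] real ∕ measure arithmetic).
* §1 `mgf_indicator_one`: `mgf 1_S μ t = μ(univ) + (e^t − 1)·μ(S)` — the dressed class term of an INDICATOR observable reads the class mass and `μ(S)`.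
* §2 (reals) `exp_shift_bounds` (shared bookkeeping) · `abs_div_sub_div_le_of_sandwiches` (the `t = 0` and `t = l₀` sandwiches of the two runs' indicator MGFs with the SAME constant pin the normalised
  set masses: `|sB∕mB − sA∕mA| ≤ (e^{2r} − 1)(1 + λ)∕λ`, `λ = e^{l₀} − 1`) · `abs_div_sub_div_le_of_sandwich_pair` (a per-class measure sandwich read on `S` and
  on `univ`: `≤ e^{2r} − 1`) · `ratio_sandwich_of_abs_sub_le` (`e ≤ EA, EB`, `|EB − EA| ≤ Δ` ⇒ `e^{−Δ∕e}·EA ≤ EB ≤ e^{Δ∕e}·EA`; `1 + x ≤ e^x`, NO smallness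
  condition) · `sandwich_mul_of_sandwiches` (mass sandwich × normalised-mean sandwich).
* §2 (measures) ★ `abs_integral_sub_integral_le_of_tv` (TV `ρ` ⇒ `|∫f dν₂ − ∫f dν₁| ≤ (M − m)·ρ` for measurable `m ≤ f ≤ M`: layer cake
  `Integrable.integral_eq_integral_Ioc_meas_le` on `f − m`; no Hahn set) · `real_sandwich_of_measure_sandwich` ∕ `ennreal_sandwich_of_real` ∕
  `real_sandwich_of_ennreal` (p496221's `ℝ≥0∞` MASS_cl ∕ SHAPE_cl letters ↔ real masses) · ★ `abs_tiltedMean_sub_tiltedMean_le_of_tv` (TV `ρ` ⇒ the tilted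
  means of `|F| ≤ B` are `4B·e^{2|s|B}·ρ`-close at every tilt `s`: centre the test function at run A's tilted mean, range `4B·e^{|s|B}`, denominator
  `≥ e^{−|s|B}`).
* §3 ★ `tv_not_shape_toy`: on `Bool`, `μA = δ_false`, `μB = δ_false + ρ·δ_true` (`ρ > 0`): the normalised laws are `ρ`-close on every set, but NO `(c, r)`
  gives `e^{c−r}·μA ≤ μB ≤ e^{c+r}·μA` — TV tolerates a SUPPORT MISMATCH of the two runs' class pieces (two runs with different cut-off functions do exactly
  this), a measure sandwich (SHAPE_cl ∕ NE7-S_cl ∕ DENS_cl of p496221 ∕ lens decomp v6–v7) does not.  So SHAPE ⇒ TV (`…N19CoreTVInvariant.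
  tvSandwich_of_shapeSandwich`) is STRICT.
NEAREST TREE ART, CITED NOT RESTATED: ne1 gen 5 `TiltedMeanVisibilityTwoRun.abs_tiltedMean_comp_sub_comp_le` (the L¹-LEDGER form of the tilted-mean
bound, densities w.r.t. a common reference measure, `2B·e^{2|s|B}·∫|mB − c·mA|`); n14-c J `ConvexFibreConsistency.abs_tiltedMean_tilted_sub_le` (the
tilt ∕ SHAPE form); p496221 `…N19ClassSandwichRoad` §3 (MASS × SHAPE split); the tree's `T4HybridMatching.integral_sandwich` (FUNCTION sandwich, one measure).

HONEST FRAMING.  Elementary; hypothesis shapes only; nothing of Bałaban's instantiated; discharges nothing; NE7 NOT PRINTED ∕ NOT proved; N19 NOT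
discharged (0∕1); K3⁗ NOT claimed; counts UNMOVED (typed 28∕28 · discharged 5∕27 · A 5∕28); one finite four-torus programme at fixed `ε` — NOT ℝ⁴,
NOT OS, NOT a mass gap, NOT Clay.  0 `def`; 0 `sorry`; standard axioms.
-/

set_option autoImplicit false

noncomputable section

open MeasureTheory ProbabilityTheory
open scoped ENNReal

namespace Summit.QuantumFields.YangMills.BalabanUVNodes.N19TVCurrency

open Summit.QuantumFields.BalabanUV.T4Continuum.NE1p.DressedMGFForm (tiltedMean)
open Summit.QuantumFields.BalabanUV.T4Continuum.NE1p.TiltedMeanInfluence (tiltedMean_eq_div abs_tiltedMean_le)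

/-! ## §1 The moment generating function of an indicator observable -/

/-- `mgf (1_S) μ t = μ(univ) + (e^t − 1)·μ(S)` for a finite measure and a measurable set: the dressed class term of the INDICATOR
observable reads off the class mass and the mass of `S`. [folklore] -/
theorem mgf_indicator_one {α : Type*} [MeasurableSpace α] (μ : Measure α) [IsFiniteMeasure μ] {S : Set α}
    (hS : MeasurableSet S) (t : ℝ) :
    mgf (S.indicator 1) μ t = μ.real Set.univ + (Real.exp t - 1) * μ.real S := by
  have hpt : ∀ x, Real.exp (t * S.indicator 1 x) = 1 + (Real.exp t - 1) * S.indicator 1 x := fun x => by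
    by_cases hx : x ∈ S
    · simp [Set.indicator_of_mem hx]
    · simp [Set.indicator_of_notMem hx]
  have hind : Integrable (fun x => (Real.exp t - 1) * S.indicator 1 x) μ :=
    Integrable.const_mul ((integrable_const (1 : ℝ)).indicator hS) _
  simp only [mgf, hpt]
  rw [integral_add (integrable_const _) hind, integral_const, smul_eq_mul, mul_one, integral_const_mul,
    integral_indicator_one hS]

/-! ## §2 One class: real and measure arithmetic [folklore] -/

/-- Bookkeeping shared by the two sandwich lemmas: from `e^{c−r}·mA ≤ mB ≤ e^{c+r}·mA` the shifted bounds `e^{c+r}·mA ≤ e^{2r}·mB` and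
`e^{−2r}·mB ≤ e^{c−r}·mA`, and the numerical fact `1 − e^{−2r} ≤ e^{2r} − 1`. [folklore] -/
theorem exp_shift_bounds {mA mB c r : ℝ} (h0 : Real.exp (c - r) * mA ≤ mB ∧ mB ≤ Real.exp (c + r) * mA) :
    Real.exp (c + r) * mA ≤ Real.exp (2 * r) * mB ∧ Real.exp (-(2 * r)) * mB ≤ Real.exp (c - r) * mA ∧
      1 - Real.exp (-(2 * r)) ≤ Real.exp (2 * r) - 1 := by
  have hup : Real.exp (c + r) = Real.exp (2 * r) * Real.exp (c - r) := by rw [← Real.exp_add]; congr 1; ring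
  have hdn : Real.exp (c - r) = Real.exp (-(2 * r)) * Real.exp (c + r) := by rw [← Real.exp_add]; congr 1; ring
  refine ⟨?_, ?_, ?_⟩
  · rw [hup, mul_assoc]; exact mul_le_mul_of_nonneg_left h0.1 (Real.exp_pos _).le
  · rw [hdn, mul_assoc]; exact mul_le_mul_of_nonneg_left h0.2 (Real.exp_pos _).le
  · have h1 : Real.exp (-(2 * r)) * Real.exp (2 * r) = 1 := by rw [← Real.exp_add]; simp
    nlinarith [Real.exp_pos (-(2 * r)), Real.exp_pos (2 * r), sq_nonneg (Real.exp (2 * r) - 1)]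

/-- NECESSITY ARITHMETIC.  Class masses `mA, mB`, set masses `0 ≤ sA ≤ mA`, `0 ≤ sB ≤ mB`, `λ > 0`, `r ≥ 0`; the `t = 0` sandwich
`e^{c−r}·mA ≤ mB ≤ e^{c+r}·mA` and the `t = l₀` sandwich of the indicator MGFs `e^{c−r}(mA + λsA) ≤ mB + λsB ≤ e^{c+r}(mA + λsA)` (SAME `c`)
pin the normalised set masses: `|sB∕mB − sA∕mA| ≤ (e^{2r} − 1)(1 + λ)∕λ`. [folklore] -/
theorem abs_div_sub_div_le_of_sandwiches {mA mB sA sB c r lam : ℝ} (hmA : 0 ≤ mA) (hsA : 0 ≤ sA) (hsAm : sA ≤ mA)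
    (hsB : 0 ≤ sB) (hsBm : sB ≤ mB) (hlam : 0 < lam) (hr : 0 ≤ r)
    (h0 : Real.exp (c - r) * mA ≤ mB ∧ mB ≤ Real.exp (c + r) * mA)
    (h1 : Real.exp (c - r) * (mA + lam * sA) ≤ mB + lam * sB ∧ mB + lam * sB ≤ Real.exp (c + r) * (mA + lam * sA)) :
    |sB / mB - sA / mA| ≤ (Real.exp (2 * r) - 1) * (1 + lam) / lam := by
  have hE : 0 ≤ Real.exp (2 * r) - 1 := sub_nonneg.2 (Real.one_le_exp (by linarith))
  have hRHS : 0 ≤ (Real.exp (2 * r) - 1) * (1 + lam) / lam := by positivity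
  rcases hmA.eq_or_lt with hmA0 | hmApos
  · -- massless class: everything vanishes
    have hsA0 : sA = 0 := le_antisymm (hmA0 ▸ hsAm) hsA
    have hmB0 : mB = 0 := le_antisymm (by simpa [← hmA0] using h0.2) (by simpa [← hmA0] using h0.1)
    have hsB0 : sB = 0 := le_antisymm (hmB0 ▸ hsBm) hsB
    simp [hsA0, hsB0, hRHS]
  have hmBpos : 0 < mB := lt_of_lt_of_le (mul_pos (Real.exp_pos _) hmApos) h0.1
  obtain ⟨hA1, hA2, hE'⟩ := exp_shift_bounds h0
  -- claim U: `λ(sB·mA − sA·mB) ≤ (e^{2r} − 1)(1 + λ)·mA·mB`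
  have hU : lam * (sB * mA - sA * mB) ≤ (Real.exp (2 * r) - 1) * (1 + lam) * (mA * mB) := by
    have h := mul_le_mul_of_nonneg_right h1.2 hmA
    -- `e^{c+r}(mA + λ sA)·mA ≤ e^{2r}·mB·(mA + λ sA)`
    have h' : Real.exp (c + r) * (mA + lam * sA) * mA ≤ Real.exp (2 * r) * mB * (mA + lam * sA) := by
      have := mul_le_mul_of_nonneg_right hA1 (show 0 ≤ mA + lam * sA by positivity)
      nlinarith
    nlinarith [mul_nonneg hlam.le (mul_nonneg hE (mul_nonneg (sub_nonneg.2 hsAm) hmBpos.le))]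
  -- claim L: `λ(sA·mB − sB·mA) ≤ (e^{2r} − 1)(1 + λ)·mA·mB`
  have hL : lam * (sA * mB - sB * mA) ≤ (Real.exp (2 * r) - 1) * (1 + lam) * (mA * mB) := by
    have h := mul_le_mul_of_nonneg_right h1.1 hmA
    have h' : Real.exp (-(2 * r)) * mB * (mA + lam * sA) ≤ Real.exp (c - r) * (mA + lam * sA) * mA := by
      have := mul_le_mul_of_nonneg_right hA2 (show 0 ≤ mA + lam * sA by positivity)
      nlinarith
    have hE0 : 0 ≤ 1 - Real.exp (-(2 * r)) := sub_nonneg.2 (Real.exp_le_one_iff.2 (by linarith))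
    nlinarith [mul_nonneg hlam.le (mul_nonneg hE0 (mul_nonneg (sub_nonneg.2 hsAm) hmBpos.le)),
      mul_nonneg (mul_nonneg hE0 (by positivity : 0 ≤ 1 + lam)) (mul_nonneg hmA hmBpos.le),
      mul_le_mul_of_nonneg_right hE' (by positivity : 0 ≤ (1 + lam) * (mA * mB))]
  have hkey : |sB * mA - sA * mB| ≤ (Real.exp (2 * r) - 1) * (1 + lam) / lam * (mA * mB) := by
    have hc1 := mul_comm lam (sB * mA - sA * mB)
    have hc2 := mul_comm lam (sA * mB - sB * mA)
    rw [abs_le]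
    constructor
    · have : sA * mB - sB * mA ≤ (Real.exp (2 * r) - 1) * (1 + lam) / lam * (mA * mB) := by
        rw [div_mul_eq_mul_div, le_div_iff₀ hlam]; linarith
      linarith
    · rw [div_mul_eq_mul_div, le_div_iff₀ hlam]; linarith
  rw [div_sub_div _ _ hmBpos.ne' hmApos.ne', abs_div, abs_of_pos (mul_pos hmBpos hmApos),
    div_le_iff₀ (mul_pos hmBpos hmApos)]
  calc |sB * mA - mB * sA| = |sB * mA - sA * mB| := by rw [mul_comm mB]
    _ ≤ _ := hkey
    _ = _ := by ring

/-- SHAPE ARITHMETIC.  A per-class measure sandwich read on one set and on the whole class — `e^{c−r}·sA ≤ sB ≤ e^{c+r}·sA`,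
`e^{c−r}·mA ≤ mB ≤ e^{c+r}·mA`, `0 ≤ sA ≤ mA`, `r ≥ 0` — pins the normalised set masses: `|sB∕mB − sA∕mA| ≤ e^{2r} − 1`. [folklore] -/
theorem abs_div_sub_div_le_of_sandwich_pair {mA mB sA sB c r : ℝ} (hmA : 0 ≤ mA) (hsA : 0 ≤ sA) (hsAm : sA ≤ mA)
    (hr : 0 ≤ r) (hm : Real.exp (c - r) * mA ≤ mB ∧ mB ≤ Real.exp (c + r) * mA)
    (hs : Real.exp (c - r) * sA ≤ sB ∧ sB ≤ Real.exp (c + r) * sA) :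
    |sB / mB - sA / mA| ≤ Real.exp (2 * r) - 1 := by
  have hE : 0 ≤ Real.exp (2 * r) - 1 := sub_nonneg.2 (Real.one_le_exp (by linarith))
  rcases hmA.eq_or_lt with hmA0 | hmApos
  · have hsA0 : sA = 0 := le_antisymm (hmA0 ▸ hsAm) hsA
    have hmB0 : mB = 0 := le_antisymm (by simpa [← hmA0] using hm.2) (by simpa [← hmA0] using hm.1)
    simp [hsA0, hmB0, hE]
  have hmBpos : 0 < mB := lt_of_lt_of_le (mul_pos (Real.exp_pos _) hmApos) hm.1
  obtain ⟨hA1, hA2, hE'⟩ := exp_shift_bounds hm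
  have hE0 : 0 ≤ 1 - Real.exp (-(2 * r)) := sub_nonneg.2 (Real.exp_le_one_iff.2 (by linarith))
  -- U: `sB·mA ≤ e^{c+r}·sA·mA ≤ e^{2r}·mB·sA`
  have hU : sB * mA - sA * mB ≤ (Real.exp (2 * r) - 1) * (mA * mB) := by
    have h := mul_le_mul_of_nonneg_right hs.2 hmA
    have h' := mul_le_mul_of_nonneg_right hA1 hsA
    nlinarith [mul_nonneg hE (mul_nonneg (sub_nonneg.2 hsAm) hmBpos.le)]
  -- L: `sB·mA ≥ e^{c−r}·sA·mA ≥ e^{−2r}·mB·sA`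
  have hL : sA * mB - sB * mA ≤ (Real.exp (2 * r) - 1) * (mA * mB) := by
    have h := mul_le_mul_of_nonneg_right hs.1 hmA
    have h' := mul_le_mul_of_nonneg_right hA2 hsA
    nlinarith [mul_nonneg hE0 (mul_nonneg (sub_nonneg.2 hsAm) hmBpos.le),
      mul_le_mul_of_nonneg_right hE' (mul_nonneg hmA hmBpos.le)]
  rw [div_sub_div _ _ hmBpos.ne' hmApos.ne', abs_div, abs_of_pos (mul_pos hmBpos hmApos),
    div_le_iff₀ (mul_pos hmBpos hmApos), abs_le]
  constructor <;> nlinarith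

/-- RATIO SANDWICH FROM CLOSENESS.  Two quantities bounded below by `e > 0` and `Δ`-close are `e^{±Δ∕e}`-comparable:
`e^{−Δ∕e}·EA ≤ EB ≤ e^{Δ∕e}·EA` (`1 + x ≤ e^x`; NO smallness condition on `Δ`). [folklore] -/
theorem ratio_sandwich_of_abs_sub_le {EA EB e Δ : ℝ} (he : 0 < e) (hEA : e ≤ EA) (hEB : e ≤ EB) (hΔ : |EB - EA| ≤ Δ) :
    Real.exp (-(Δ / e)) * EA ≤ EB ∧ EB ≤ Real.exp (Δ / e) * EA := by
  have hΔ0 : 0 ≤ Δ := (abs_nonneg _).trans hΔ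
  have hx : 1 + Δ / e ≤ Real.exp (Δ / e) := by linarith [Real.add_one_le_exp (Δ / e)]
  obtain ⟨h1, h2⟩ := abs_le.mp hΔ
  have hEApos : 0 < EA := he.trans_le hEA
  have hEBpos : 0 < EB := he.trans_le hEB
  -- `Δ ≤ (Δ/e)·EA` and `Δ ≤ (Δ/e)·EB`
  have hd : ∀ {y : ℝ}, e ≤ y → Δ ≤ Δ / e * y := fun {y} hy =>
    calc Δ = Δ / e * e := by field_simp
      _ ≤ Δ / e * y := mul_le_mul_of_nonneg_left hy (div_nonneg hΔ0 he.le)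
  have hdA := hd hEA
  have hdB := hd hEB
  constructor
  · -- `EA ≤ EB + Δ ≤ EB(1 + Δ/e) ≤ e^{Δ/e}·EB`
    have h : EA ≤ Real.exp (Δ / e) * EB := by nlinarith [mul_le_mul_of_nonneg_right hx hEBpos.le]
    have h' := mul_le_mul_of_nonneg_left h (Real.exp_pos (-(Δ / e))).le
    rwa [← mul_assoc, ← Real.exp_add, neg_add_cancel, Real.exp_zero, one_mul] at h'
  · nlinarith [mul_le_mul_of_nonneg_right hx hEApos.le]

/-- PRODUCT OF SANDWICHES: masses `e^{c ± r₁}`-comparable and normalised means `e^{±w}`-comparable ⇒ dressed class terms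
`mA·EA`, `mB·EB` are `e^{c ± (r₁ + w)}`-comparable. [folklore] -/
theorem sandwich_mul_of_sandwiches {mA mB EA EB c r₁ w : ℝ} (hmA : 0 ≤ mA) (hEA : 0 ≤ EA)
    (hM : Real.exp (c - r₁) * mA ≤ mB ∧ mB ≤ Real.exp (c + r₁) * mA)
    (hE : Real.exp (-w) * EA ≤ EB ∧ EB ≤ Real.exp w * EA) :
    Real.exp (c - (r₁ + w)) * (mA * EA) ≤ mB * EB ∧ mB * EB ≤ Real.exp (c + (r₁ + w)) * (mA * EA) := by
  have hmB : 0 ≤ mB := le_trans (mul_nonneg (Real.exp_pos _).le hmA) hM.1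
  have hEB : 0 ≤ EB := le_trans (mul_nonneg (Real.exp_pos _).le hEA) hE.1
  have e1 : Real.exp (c - (r₁ + w)) = Real.exp (c - r₁) * Real.exp (-w) := by
    rw [← Real.exp_add]; congr 1; ring
  have e2 : Real.exp (c + (r₁ + w)) = Real.exp (c + r₁) * Real.exp w := by
    rw [← Real.exp_add]; congr 1; ring
  constructor
  · calc Real.exp (c - (r₁ + w)) * (mA * EA) = (Real.exp (c - r₁) * mA) * (Real.exp (-w) * EA) := by
          rw [e1]; ring
      _ ≤ mB * EB := mul_le_mul hM.1 hE.1 (mul_nonneg (Real.exp_pos _).le hEA) hmB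
  · calc mB * EB ≤ (Real.exp (c + r₁) * mA) * (Real.exp w * EA) :=
          mul_le_mul hM.2 hE.2 hEB (mul_nonneg (Real.exp_pos _).le hmA)
      _ = Real.exp (c + (r₁ + w)) * (mA * EA) := by
          rw [e2]; ring

/-- **SETS ⇒ FUNCTIONS (total variation).**  Two probability laws that are `ρ`-close on every measurable SET integrate every measurable
`f` with `m ≤ f ≤ M` within `(M − m)·ρ` — layer cake (Mathlib `Integrable.integral_eq_integral_Ioc_meas_le`) on `f − m`; no Hahn set,
no reference measure. [folklore] -/
theorem abs_integral_sub_integral_le_of_tv {α : Type*} [MeasurableSpace α] {ν₁ ν₂ : Measure α} [IsProbabilityMeasure ν₁]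
    [IsProbabilityMeasure ν₂] {f : α → ℝ} {m M ρ : ℝ} (hfm : Measurable f) (hlo : ∀ x, m ≤ f x) (hhi : ∀ x, f x ≤ M)
    (hmM : m ≤ M) (hTV : ∀ S, MeasurableSet S → |ν₂.real S - ν₁.real S| ≤ ρ) :
    |∫ x, f x ∂ν₂ - ∫ x, f x ∂ν₁| ≤ (M - m) * ρ := by
  set g : α → ℝ := fun x => f x - m with hg
  have hgm : Measurable g := hfm.sub measurable_const
  have hg0 : ∀ x, 0 ≤ g x := fun x => sub_nonneg.2 (hlo x)
  have hgM : ∀ x, g x ≤ M - m := fun x => sub_le_sub_right (hhi x) m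
  have hgi : ∀ (ν : Measure α) [IsProbabilityMeasure ν], Integrable g ν := fun ν _ =>
    (integrable_const (M - m)).mono' hgm.aestronglyMeasurable
      (ae_of_all _ fun x => by rw [Real.norm_eq_abs, abs_of_nonneg (hg0 x)]; exact hgM x)
  have hshift : ∀ (ν : Measure α) [IsProbabilityMeasure ν], ∫ x, f x ∂ν = ∫ x, g x ∂ν + m := fun ν _ => by
    have : (fun x => f x) = fun x => g x + m := funext fun x => by simp [hg]
    rw [this, integral_add (hgi ν) (integrable_const m), integral_const, smul_eq_mul, probReal_univ, one_mul]
  have hcake : ∀ (ν : Measure α) [IsProbabilityMeasure ν],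
      ∫ x, g x ∂ν = ∫ s in Set.Ioc 0 (M - m), ν.real {a | s ≤ g a} := fun ν _ =>
    (hgi ν).integral_eq_integral_Ioc_meas_le (ae_of_all _ hg0) (ae_of_all _ hgM)
  have hlev : ∀ (ν : Measure α) [IsProbabilityMeasure ν],
      IntegrableOn (fun s => ν.real {a | s ≤ g a}) (Set.Ioc 0 (M - m)) := fun ν _ => by
    refine Measure.integrableOn_of_bounded (M := 1) measure_Ioc_lt_top.ne
      (Measurable.aestronglyMeasurable ?_) (ae_of_all _ fun s => ?_)
    · exact Measurable.ennreal_toReal (Antitone.measurable fun _ _ hst => measure_mono fun _ h => le_trans hst h)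
    · rw [Real.norm_eq_abs, abs_of_nonneg measureReal_nonneg]; exact measureReal_le_one
  rw [hshift ν₂, hshift ν₁, add_sub_add_right_eq_sub, hcake ν₂, hcake ν₁, ← integral_sub (hlev ν₂) (hlev ν₁)]
  have hmeas : ∀ s, MeasurableSet {a | s ≤ g a} := fun s => hgm measurableSet_Ici
  calc |∫ s in Set.Ioc 0 (M - m), (ν₂.real {a | s ≤ g a} - ν₁.real {a | s ≤ g a})|
      = ‖∫ s in Set.Ioc 0 (M - m), (ν₂.real {a | s ≤ g a} - ν₁.real {a | s ≤ g a})‖ := (Real.norm_eq_abs _).symm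
    _ ≤ ρ * (volume : Measure ℝ).real (Set.Ioc 0 (M - m)) :=
        norm_setIntegral_le_of_norm_le_const measure_Ioc_lt_top fun s _ => by
          rw [Real.norm_eq_abs]; exact hTV _ (hmeas s)
    _ = (M - m) * ρ := by rw [Real.volume_real_Ioc_of_le (sub_nonneg.2 hmM), sub_zero, mul_comm]

/-- Measure sandwich ⇒ real sandwich on any set (finite reference piece). [folklore] -/
theorem real_sandwich_of_measure_sandwich {α : Type*} [MeasurableSpace α] {μ ν : Measure α} [IsFiniteMeasure μ] {a b : ℝ}
    (ha : 0 ≤ a) (hb : 0 ≤ b) (hlo : ENNReal.ofReal a • μ ≤ ν) (hhi : ν ≤ ENNReal.ofReal b • μ) (s : Set α) :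
    a * μ.real s ≤ ν.real s ∧ ν.real s ≤ b * μ.real s := by
  have h1 := Measure.le_iff'.1 hlo s
  have h2 := Measure.le_iff'.1 hhi s
  simp only [Measure.smul_apply, smul_eq_mul] at h1 h2
  have hνs : ν s ≠ ∞ := ne_top_of_le_ne_top (ENNReal.mul_ne_top ENNReal.ofReal_ne_top (measure_ne_top μ s)) h2
  refine ⟨?_, ?_⟩
  · have := ENNReal.toReal_mono hνs h1
    rwa [ENNReal.toReal_mul, ENNReal.toReal_ofReal ha] at this
  · have := ENNReal.toReal_mono (ENNReal.mul_ne_top ENNReal.ofReal_ne_top (measure_ne_top μ s)) h2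
    rwa [ENNReal.toReal_mul, ENNReal.toReal_ofReal hb] at this

/-- Real mass sandwich ⇒ the `ℝ≥0∞` mass sandwich of p496221's MASS_cl letters (finite pieces). [folklore] -/
theorem ennreal_sandwich_of_real {α : Type*} [MeasurableSpace α] {μ ν : Measure α} [IsFiniteMeasure μ] [IsFiniteMeasure ν]
    {a b : ℝ} (ha : 0 ≤ a) (hb : 0 ≤ b) (h : a * μ.real Set.univ ≤ ν.real Set.univ ∧ ν.real Set.univ ≤ b * μ.real Set.univ) :
    ENNReal.ofReal a * μ Set.univ ≤ ν Set.univ ∧ ν Set.univ ≤ ENNReal.ofReal b * μ Set.univ := by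
  rw [← ofReal_measureReal (measure_ne_top μ _), ← ofReal_measureReal (measure_ne_top ν _), ← ENNReal.ofReal_mul ha,
    ← ENNReal.ofReal_mul hb]
  exact ⟨ENNReal.ofReal_le_ofReal h.1, ENNReal.ofReal_le_ofReal h.2⟩

/-- `ℝ≥0∞` mass sandwich ⇒ real mass sandwich (finite pieces). [folklore] -/
theorem real_sandwich_of_ennreal {α : Type*} [MeasurableSpace α] {μ ν : Measure α} [IsFiniteMeasure μ] [IsFiniteMeasure ν]
    {a b : ℝ} (ha : 0 ≤ a) (hb : 0 ≤ b)
    (h : ENNReal.ofReal a * μ Set.univ ≤ ν Set.univ ∧ ν Set.univ ≤ ENNReal.ofReal b * μ Set.univ) :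
    a * μ.real Set.univ ≤ ν.real Set.univ ∧ ν.real Set.univ ≤ b * μ.real Set.univ := by
  refine ⟨?_, ?_⟩
  · have := ENNReal.toReal_mono (measure_ne_top ν _) h.1
    rwa [ENNReal.toReal_mul, ENNReal.toReal_ofReal ha] at this
  · have := ENNReal.toReal_mono (ENNReal.mul_ne_top ENNReal.ofReal_ne_top (measure_ne_top μ _)) h.2
    rwa [ENNReal.toReal_mul, ENNReal.toReal_ofReal hb] at this

/-- **SETS ⇒ TILTED MEANS.**  Two probability laws `ρ`-close on every measurable set have `4B·e^{2|s|B}·ρ`-close tilted means of every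
measurable `|F| ≤ B` at every tilt `s`: with `q` run A's tilted mean, `∫(F − q)e^{sF} dν₁ = 0`, so the difference is
`∫(F − q)e^{sF} d(ν₂ − ν₁) ∕ ∫e^{sF} dν₂`, numerator by `abs_integral_sub_integral_le_of_tv` (range `4B·e^{|s|B}`), denominator `≥ e^{−|s|B}`.
(Reference-measure form with densities: ne1 gen 5 `TiltedMeanVisibilityTwoRun.abs_tiltedMean_comp_sub_comp_le`, `2B·e^{2|s|B}·∫|mB − c·mA|`.) [folklore] -/
theorem abs_tiltedMean_sub_tiltedMean_le_of_tv {α : Type*} [MeasurableSpace α] {ν₁ ν₂ : Measure α} [IsProbabilityMeasure ν₁]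
    [IsProbabilityMeasure ν₂] {F : α → ℝ} {B ρ : ℝ} (hFm : Measurable F) (hF : ∀ x, |F x| ≤ B)
    (hTV : ∀ S, MeasurableSet S → |ν₂.real S - ν₁.real S| ≤ ρ) (s : ℝ) :
    |tiltedMean F ν₂ s - tiltedMean F ν₁ s| ≤ 4 * B * Real.exp (2 * (|s| * B)) * ρ := by
  obtain ⟨x₀, -⟩ := nonempty_of_measure_ne_zero (μ := ν₁) (s := Set.univ) (by simp)
  have hB : 0 ≤ B := (abs_nonneg _).trans (hF x₀)
  have hρ : 0 ≤ ρ := (abs_nonneg _).trans (hTV ∅ MeasurableSet.empty)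
  set E : α → ℝ := fun x => Real.exp (s * F x) with hE
  have hsF : ∀ x, |s * F x| ≤ |s| * B := fun x => by
    rw [abs_mul]; exact mul_le_mul_of_nonneg_left (hF x) (abs_nonneg s)
  have hEle : ∀ x, E x ≤ Real.exp (|s| * B) := fun x => Real.exp_le_exp.2 (abs_le.1 (hsF x)).2
  have hEge : ∀ x, Real.exp (-(|s| * B)) ≤ E x := fun x => Real.exp_le_exp.2 (abs_le.1 (hsF x)).1
  have hEpos : ∀ x, 0 < E x := fun x => Real.exp_pos _
  have hEm : Measurable E := (measurable_const.mul hFm).exp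
  have hFEm : Measurable fun x => F x * E x := hFm.mul hEm
  have hEi : ∀ (ν : Measure α) [IsProbabilityMeasure ν], Integrable E ν := fun ν _ =>
    (integrable_const (Real.exp (|s| * B))).mono' hEm.aestronglyMeasurable
      (ae_of_all _ fun x => by rw [Real.norm_eq_abs, abs_of_pos (hEpos x)]; exact hEle x)
  have hFEi : ∀ (ν : Measure α) [IsProbabilityMeasure ν], Integrable (fun x => F x * E x) ν := fun ν _ =>
    (integrable_const (B * Real.exp (|s| * B))).mono' hFEm.aestronglyMeasurable
      (ae_of_all _ fun x => by
        rw [Real.norm_eq_abs, abs_mul, abs_of_pos (hEpos x)]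
        exact mul_le_mul (hF x) (hEle x) (hEpos x).le hB)
  have hZge : ∀ (ν : Measure α) [IsProbabilityMeasure ν], Real.exp (-(|s| * B)) ≤ ∫ x, E x ∂ν := fun ν _ => by
    have := integral_mono (integrable_const _) (hEi ν) hEge
    rwa [integral_const, smul_eq_mul, probReal_univ, one_mul] at this
  set NA := ∫ x, F x * E x ∂ν₁ with hNA
  set ZA := ∫ x, E x ∂ν₁ with hZA
  set NB := ∫ x, F x * E x ∂ν₂ with hNB
  set ZB := ∫ x, E x ∂ν₂ with hZB
  have hZApos : 0 < ZA := (Real.exp_pos _).trans_le (hZge ν₁)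
  have hZBpos : 0 < ZB := (Real.exp_pos _).trans_le (hZge ν₂)
  have hA : tiltedMean F ν₁ s = NA / ZA := tiltedMean_eq_div F ν₁ s
  have hBq : tiltedMean F ν₂ s = NB / ZB := tiltedMean_eq_div F ν₂ s
  set q : ℝ := NA / ZA with hq
  have hqB : |q| ≤ B := by rw [← hA]; exact abs_tiltedMean_le hF hB s
  -- the centred test function `g = (F − q)·E`, range `[−2B e^{|s|B}, 2B e^{|s|B}]`
  have hgm : Measurable fun x => (F x - q) * E x := (hFm.sub measurable_const).mul hEm
  have hgb : ∀ x, |(F x - q) * E x| ≤ 2 * B * Real.exp (|s| * B) := fun x => by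
    rw [abs_mul, abs_of_pos (hEpos x)]
    have : |F x - q| ≤ 2 * B := by
      calc |F x - q| ≤ |F x| + |q| := abs_sub _ _
        _ ≤ B + B := add_le_add (hF x) hqB
        _ = 2 * B := by ring
    exact mul_le_mul this (hEle x) (hEpos x).le (by positivity)
  have hglo : ∀ x, -(2 * B * Real.exp (|s| * B)) ≤ (F x - q) * E x := fun x => (abs_le.1 (hgb x)).1
  have hghi : ∀ x, (F x - q) * E x ≤ 2 * B * Real.exp (|s| * B) := fun x => (abs_le.1 (hgb x)).2
  have hgint : ∀ (ν : Measure α) [IsProbabilityMeasure ν],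
      ∫ x, (F x - q) * E x ∂ν = ∫ x, F x * E x ∂ν - q * ∫ x, E x ∂ν := fun ν _ => by
    have : (fun x => (F x - q) * E x) = fun x => F x * E x - q * E x := funext fun x => by ring
    rw [this, integral_sub (hFEi ν) ((hEi ν).const_mul q), integral_const_mul]
  have htv := abs_integral_sub_integral_le_of_tv hgm hglo hghi (by linarith [mul_nonneg (mul_nonneg zero_le_two hB) (Real.exp_pos (|s| * B)).le]) hTV
  rw [hgint ν₂, hgint ν₁] at htv
  have h0 : NA - q * ZA = 0 := by rw [hq, div_mul_cancel₀ _ hZApos.ne', sub_self]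
  rw [← hNA, ← hZA, ← hNB, ← hZB, h0, sub_zero] at htv
  have hdiff : tiltedMean F ν₂ s - tiltedMean F ν₁ s = (NB - q * ZB) / ZB := by
    rw [hBq, hA]; field_simp
  rw [hdiff, abs_div, abs_of_pos hZBpos, div_le_iff₀ hZBpos]
  calc |NB - q * ZB| ≤ (2 * B * Real.exp (|s| * B) - -(2 * B * Real.exp (|s| * B))) * ρ := htv
    _ = 4 * B * Real.exp (|s| * B) * ρ := by ring
    _ = 4 * B * Real.exp (2 * (|s| * B)) * ρ * Real.exp (-(|s| * B)) := by
        rw [show (2 : ℝ) * (|s| * B) = |s| * B + |s| * B by ring, Real.exp_add, Real.exp_neg]; field_simp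
    _ ≤ 4 * B * Real.exp (2 * (|s| * B)) * ρ * ZB := mul_le_mul_of_nonneg_left (hZge ν₂) (by positivity)

/-! ## §3 Strictness: TV-closeness of the normalised laws does NOT give a measure sandwich -/

/-- **TV_cl ⇏ SHAPE_cl** (two-point toy): run A's class piece `δ_false`, run B's `δ_false + ρ·δ_true` (`ρ > 0`: run B puts mass where run A has
none — different cut-off functions of the two runs do exactly this).  The normalised laws are `ρ`-close on every set, yet NO `(c, r)` sandwiches the
measures (`μB{true} = ρ > 0 = e^{c+r}·μA{true}`).  So the observable-uniform core needs strictly LESS than SHAPE_cl ∕ NE7-S_cl ∕ DENS_cl. [folklore] -/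
theorem tv_not_shape_toy {ρ : ℝ} (hρ : 0 < ρ) :
    (∀ S : Set Bool,
        |(Measure.dirac false + ENNReal.ofReal ρ • Measure.dirac true).real S /
              (Measure.dirac false + ENNReal.ofReal ρ • Measure.dirac true).real Set.univ -
            (Measure.dirac false : Measure Bool).real S / (Measure.dirac false : Measure Bool).real Set.univ| ≤ ρ) ∧
      ¬ ∃ c r : ℝ,
        ENNReal.ofReal (Real.exp (c - r)) • (Measure.dirac false : Measure Bool) ≤
            Measure.dirac false + ENNReal.ofReal ρ • Measure.dirac true ∧
          Measure.dirac false + ENNReal.ofReal ρ • Measure.dirac true ≤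
            ENNReal.ofReal (Real.exp (c + r)) • (Measure.dirac false : Measure Bool) := by
  have hAS : ∀ S : Set Bool, (Measure.dirac false : Measure Bool) S = S.indicator 1 false := fun S => by
    rw [Measure.dirac_apply]
  have hBS : ∀ S : Set Bool, (Measure.dirac false + ENNReal.ofReal ρ • Measure.dirac true) S =
      S.indicator 1 false + ENNReal.ofReal ρ * S.indicator 1 true := fun S => by
    rw [Measure.add_apply, Measure.smul_apply, smul_eq_mul, Measure.dirac_apply, Measure.dirac_apply]
  have hkey : ρ / (1 + ρ) ≤ ρ := div_le_self hρ.le (by linarith)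
  have hρ1 : (1 + ρ) ≠ 0 := by positivity
  refine ⟨fun S => ?_, ?_⟩
  · simp only [measureReal_def, hAS, hBS]
    by_cases hf : false ∈ S
    · by_cases ht : true ∈ S
      · -- both points in `S`: `(1+ρ)∕(1+ρ) − 1∕1 = 0`
        simp [hf, ht, ENNReal.toReal_add, ENNReal.toReal_ofReal hρ.le, hρ.le, div_self hρ1]
      · -- `false ∈ S`, `true ∉ S`: `|1∕(1+ρ) − 1| = ρ∕(1+ρ)`
        simp [hf, ht, ENNReal.toReal_add, ENNReal.toReal_ofReal hρ.le]
        have h1 : (1 + ρ)⁻¹ - 1 = -(ρ / (1 + ρ)) := by field_simp; ring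
        rw [h1, abs_neg, abs_of_nonneg (by positivity)]
        exact hkey
    · by_cases ht : true ∈ S
      · -- `false ∉ S`, `true ∈ S`: `|ρ∕(1+ρ) − 0| = ρ∕(1+ρ)`
        simp [hf, ht, ENNReal.toReal_add, ENNReal.toReal_ofReal hρ.le]
        rw [abs_of_nonneg (by positivity)]
        exact hkey
      · -- neither: `0 − 0`
        simp [hf, ht, hρ.le]
  · rintro ⟨c, r, -, hhi⟩
    have h := Measure.le_iff'.1 hhi {true}
    rw [hBS, Measure.smul_apply, smul_eq_mul, hAS] at h
    simp at h
    exact absurd h (not_le.2 hρ)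

end Summit.QuantumFields.YangMills.BalabanUVNodes.N19TVCurrency

end
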